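import Summits.QuantumFields.YangMills.Theorems.BalabanUVNodesN18AtReadingW1

/-!
# BalabanUVNodes ∕ node N18 = NE5 — THE H-LAYER END RUN ON W1's OWN CARRIERS OF RECORD `Node00.W1.histCarriers (F.P K) M p` (the `K`-th
# torus's catalogue `Node00.Sect2.domSys (F.P K) M j` of every creation step, `d_j = torusTreeLen`), hence at the W1 reading's LEVEL PAIRING and
# at the NAMED READING `𝔯_W1` WITHOUT ANY MAP OF CARRIERS (Track A, DAG node N18 = `T4OutputRate.NE5` :211; cluster K4 «SpineRates», item K3′
# `SpineGivenEndpointR12`; module 9 of seat pub-ymgap-dag-n18-d, strategy s2)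

HONEST FRAMING.  Count-neutral kernel bookkeeping (`--supports stmt-QuantumFields-19908 --as helper`).  NE5 is NOT PRINTED and NOT proved; N18 is NOT
discharged.  What this file does: the NE5 END of the cell's chain — `Spine/NE5/EnvelopeOnRecord` §1 ∕ §2 (the output envelope from H-layer data ∘
`LeafIndex.ne5_of_leaves_fibre`, every geometry binder discharged by the four-torus catalogue `TreeLengthTorus.tsys 4 N` with the located numerals
ν = 9, c₁ = 64, K₀ = `B12TreeDecay.K₀ 64 8`, κ₀ = 64·log 162) — was run in module 1 (`n18At_of_envelopeOnRecord`, p451455) on row NE5's paired-torus carriers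
`B13Carriers.TwoRuns.carriers` (`Dom = Σ j, TDom 4 (cubesPerDir j)`); module 8 (`…N18AtReadingW1`, p470160) then needs MAPS of W1's level-`k` carriers into
those (§3's `φD φA φB` + two agreement clauses).  HERE the END is run DIRECTLY on W1's carriers of record: `histCarriers (F.P K) M p` has
`Dom = Σ j, (Sect2.domSys (F.P K) M j).Dom = Σ j, TDom 4 (Sect2.domCount (F.P K) M j)` (`(F.P K).d = 4` by `rfl`), `scale = j`, `d ⟨j, X⟩ = torusTreeLen X`
BY DEFINITION — the same shape as the carriers of record, with the definer's cube count `domCount (F.P K) M j` for `cubesPerDir j` — so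
`EnvelopeOnRecord`'s §2 proof goes through VERBATIM and NO map, NO footprint, NO identification clause is left:
* §1 `outputEnvelope_of_activities_histCarriers` ∕ `ne5_of_leaves_fibre_activities_histCarriers` ∕ `…_eps` — for ANY step model over
  `histCarriers (F.P K) M p` whose output at `⟨j, X⟩` IS (2.13) of scale-`j` activities on the definer's catalogue `tsys 4 (domCount (F.P K) M j)` (`hrep`),
  the H-layer datum with THE NODE-A MAJORANT AS HYPOTHESIS (`hH`, [II] Lemma 3 (2.38): instanced by nobody) and the two one-run clauses in located numerals
  ⇒ `OutputEnvelope`; with the leaves L01–L03 ∕ L05–L09unit, [KP86]'s reach L10 and L11 (or the sharp clause at `A = C₃ε₁`) ⇒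
  `T4OutputRate.NE5 EA EB W κ θ′ C₅(A)` for ANY functionals `EA ∕ EB` on W1's carriers.
* §2 `n18At_pairing_of_envelopeOnW1Carriers` (+ `…_eps`: both W2 clauses as ONE ε₁-threshold; `endConstant_nonneg`: `0 ≤ C₅(C₃ε₁)` from the letters) — member by member `b ∈ ]0, γ]` at a W1 LEVEL PAIRING `R : Node00.W1.LevelPairing F 𝔸 M k` (carriers
  `R.carriers = histCarriers (F.P k) M R.toRunPairing`): `N18At ⟨R.carriers, W, γ, κ, EA, EB, θ′, C₅(C₃ε₁), …⟩` — module 1's `n18At_of_envelopeOnRecord` twin.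
* §3 `n18At_u3OfRecord₁₂_w1_of_envelopeOnW1Carriers` — AT THE NAMED READING, PER RUN LENGTH, NO MAPS: for `𝔯_W1`'s input datum `𝔇`, per-member step
  models ON `((𝔇.w1 F θ).pairing k).carriers` representing (2.13) of activities on the `k`-th torus's catalogue with the NODE-A majorant, the leaves stated
  ON W1's OWN FUNCTIONALS `(pairing k).EA (S k)` (run A: `Re E^{(j)}(X; g; embA U)`) and `(pairing k).EB (S (k+1)) b` (run B through the pairing), the
  located numerals and the reading's letters dominating (`κ_ℓ ≤ κ`, `θ′ ≤ θ₅`, `C₅(C₃ε₁) ≤ C₅`) ⇒ `N18At (u3OfRecord₁₂ θ (W1.assignment₁₂ 𝔇 F θ g₀ os).u3 k)`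
  (§2 ∘ `N18AtByName.n18At_mono` ∘ module 8's bundle equation `n18At_u3OfRecord₁₂_w1_iff_pairing`; the END's constant is shown nonnegative from the letters).
* §4 `s_N18_rRec₁₂_w1_of_envelopeOnW1Carriers` — THE ROW «knit `T4OutputRate.NE5` from `EnvelopeOnRecord*` faces with the NODE-A majorant as hypothesis at
  `RRec`» AT THE NAMED READING ON W1's OWN CARRIERS: the §3 data at every admissible Stage-12 tuple with provisos and every run length ⇒ `S_N18 (RRec₁₂ 𝔯_W1)`.
  Compared with module 8 §4 the three maps and the two agreement clauses are GONE: what remains is the H-layer ACTIVITY DATUM on the record's torus catalogue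
  (dag-n18-c's row s1: the `StepModel` over W1's carriers with (2.13) `hrep`, NODE A's (2.38) `hH`, NODE O's leaves — its `…N18HLayerW1Config` p470180 already
  delivers L05 ∕ L06 `DecayBound` at the level pairing from the (2.38) datum) and rows NE2 ∕ NE3's rates L07 ∕ L08.
One finite four-torus programme at fixed `ε`; NOT the continuum limit, NOT OS, NOT a mass gap, NOT Clay.  0 `def`, 0 `sorry`.

Sources: T. Bałaban, CMP **109** (1987) [Balaban1987RG1] (0.24)–(0.25) p. 257, Thm 1 p. 259, (1.18) p. 263; CMP **116** (1988) [Balaban1988RG2Cluster]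
(2.13)–(2.14) pp. 14–15, Lemma 3 (2.38) p. 20, (2.39)–(2.41) p. 21; CMP **119** (1988) [Balaban1988Convergent] (2.26)–(2.27) p. 259; R. Kotecký–D. Preiss,
CMP **103** (1986) [KoteckyPreiss1986].  Nothing here is a claim about the Yang–Mills mass gap.
-/

noncomputable section

open Set Metric

namespace YMDAG.N18.W1Reading

open Literature.MathematicalPhysics.QuantumFieldTheory.Balaban1983to89
open Literature.MathematicalPhysics.QuantumFieldTheory.Balaban1983to89.T4Continuum
open Literature.MathematicalPhysics.QuantumFieldTheory.Balaban1983to89.T4OutputRate (Carriers Functional NE5 Window)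
open Literature.MathematicalPhysics.QuantumFieldTheory.Balaban1983to89.T4InputCauchyRateData (StepModel)
open Literature.MathematicalPhysics.QuantumFieldTheory.Balaban1983to89.B13Resummation (locE)
open Literature.MathematicalPhysics.QuantumFieldTheory.Balaban1983to89.TreeLengthTorus (TDom tsys torusTreeLen)
open Literature.MathematicalPhysics.QuantumFieldTheory.Balaban1983to89.TreeLengthTorusGeometry (TTouch tgeometry)
open Literature.MathematicalPhysics.QuantumFieldTheory.Balaban1983to89.B12TreeDecay (K₀)
open Literature.MathematicalPhysics.QuantumFieldTheory.Balaban1983to89.Node00 (Stage12Params IsDatumOfRecord₁₂C U3Letters₁₁ U3Objects₁₁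
  RateAssignment₁₂ prependCoupling)
open Literature.MathematicalPhysics.QuantumFieldTheory.Balaban1983to89.Node00.Sect2 (domCount domSys)
open Summit.QuantumFields.BalabanUV.T4Continuum.Spine.NE5
open Summit.QuantumFields.BalabanUV.T4Continuum.NE1p.DressedOutputAnalyticFaces (analytic_and_bounded_locE_param_of_geometry)
open Summit.QuantumFields.BalabanUV.T4Continuum.NE1p.DressedSmallFieldGeometry (torus_consts)
open Summit.QuantumFields.BalabanUV.T4Continuum.NE1p.DressedSmallFieldGeometryFaces (K₀_four)
open Summit.QuantumFields.YangMills.BalabanUVNodes.N18AtByName (n18At_mono)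
open YMDAG.N18.HLayer
open YMDAG.UVSplit

variable {N : ℕ} [NeZero N]

/-! ## §1 The output envelope and E1′ from H-layer data ON W1's CARRIERS OF RECORD `histCarriers (F.P K) M p` -/

section HistCarriers

variable (F : T4Family) (K M : ℕ) (p : Node00.W1.RunPairing)
variable {Op Hist : Type*} [NormedAddCommGroup Op] [NormedSpace ℂ Op] [NormedAddCommGroup Hist] [NormedSpace ℂ Hist]
  (Mdl : StepModel (Node00.W1.histCarriers (F.P K) M p) Op Hist)
-- decidability instances as BINDERS (they unify with any consumer's; `Spine/NE5/EnvelopeOnRecord` TECHNICAL NOTE)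
variable [∀ j, DecidableEq (TDom 4 (domCount (F.P K) M j))] [∀ j, DecidableRel (TTouch (d := 4) (N := domCount (F.P K) M j))]

/-- **THE OUTPUT ENVELOPE FROM H-LAYER DATA ON W1's CARRIERS OF RECORD** [bookkeeping; `EnvelopeOnRecord.outputEnvelope_of_activities_record` with the
definer's cube count `Sect2.domCount (F.P K) M j` for `cubesPerDir j`, proof verbatim].  For a step model over `histCarriers (F.P K) M p` (domains `⟨j, X⟩` with
`X ∈ 𝐃_j` of the `K`-th torus's catalogue `Sect2.domSys (F.P K) M j = tsys 4 (domCount (F.P K) M j)`, `scale = j`, `d = torusTreeLen X` BY DEFINITION) whose output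
at `⟨j, X⟩` IS (2.13) of scale-`j` activities on that catalogue (`hrep`), the H-layer datum `hH` (near every admissible box an open set on which every activity is
ℂ-differentiable in the data and dominated by `A·e^{−R_d·d_j(Z)}` — [II] Lemma 3 (2.38), NOT instanced) and the two one-run clauses with located numerals give
`OutputEnvelope W κ (e·9·64·K₀(64,8)²·A)`. [cite: Balaban1988RG2Cluster, Lemma 3 (2.38) p.20 and (2.41) p.21; KoteckyPreiss1986, Thm 1 p.492] -/
theorem outputEnvelope_of_activities_histCarriers
    {act : (j : ℕ) → Op × Hist → TDom 4 (domCount (F.P K) M j) → ℂ} {W : Set (ℕ → ℝ)} {A Rd κ : ℝ}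
    (hrep : ∀ (X : Node00.W1.Dom (F.P K) M) (z : Op × Hist),
      Mdl.Out X.1 z.1 z.2 X =
        locE (TTouch (d := 4) (N := domCount (F.P K) M X.1)) (fun Z : (tsys 4 (domCount (F.P K) M X.1)).Dom => Z.1) (act X.1 z) X.2.1)
    (hA : 0 ≤ A) (hκ : 0 ≤ κ) (hrate : κ + 2 * (64 * Real.log 162) + 2 ≤ Rd)
    (hsmall : A * Real.exp (5 * κ + 1) * K₀ 64 8 * 9 * 64 ≤ 1)
    (hH : ∀ j, ∀ g ∈ W, ∀ (U : p.BgB) (q : Op × Hist), q ∈ Mdl.Base j g U →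
      ∃ V : Set (Op × Hist), IsOpen V ∧ Mdl.box j q ⊆ V ∧
        (∀ Z : TDom 4 (domCount (F.P K) M j), DifferentiableOn ℂ (fun z : Op × Hist => act j z Z) V) ∧
        (∀ z ∈ V, ∀ Z : TDom 4 (domCount (F.P K) M j), ‖act j z Z‖ ≤ A * Real.exp (-(Rd * torusTreeLen Z.1)))) :
    Mdl.OutputEnvelope W κ (Real.exp 1 * 9 * 64 * K₀ 64 8 ^ 2 * A) := by
  intro k g hg U q hq X hX
  obtain ⟨j, Y⟩ := X
  change j = k at hX
  subst hX
  obtain ⟨V, hV, hbox, hhol, hmaj⟩ := hH j g hg U q hq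
  obtain ⟨hν, hκ₀, hc₁⟩ := torus_consts (domCount (F.P K) M j)
  have hK := K₀_four (N := domCount (F.P K) M j)
  letI : DecidableEq (tsys 4 (domCount (F.P K) M j)).Dom := inferInstanceAs (DecidableEq (TDom 4 (domCount (F.P K) M j)))
  letI : DecidableRel (tgeometry 4 (domCount (F.P K) M j)).ι :=
    inferInstanceAs (DecidableRel (TTouch (d := 4) (N := domCount (F.P K) M j)))
  obtain ⟨hdiff, hbd⟩ :=
    analytic_and_bounded_locE_param_of_geometry (tgeometry 4 (domCount (F.P K) M j)) (P := Op × Hist)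
      (m := fun Z : (tsys 4 (domCount (F.P K) M j)).Dom => A * Real.exp (-(Rd * torusTreeLen Z.1))) (act := act j) (R := Rd) Y
      hV hA hκ (by rw [hκ₀]; exact hrate) (by rw [hK, hν, hc₁]; exact hsmall) (fun Z _ => hhol Z)
      (fun z hz Z _ => hmaj z hz Z) (fun Z _ => le_rfl)
  rw [hν, hc₁, hK] at hbd
  refine ⟨(hdiff.mono hbox).congr fun z _ => hrep ⟨j, Y⟩ z, fun z hz => ?_⟩
  have hbd' : ‖locE (TTouch (d := 4) (N := domCount (F.P K) M j)) (fun Z : (tsys 4 (domCount (F.P K) M j)).Dom => Z.1) (act j z) Y.1‖ ≤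
      Real.exp 1 * 9 * 64 * K₀ 64 8 ^ 2 * A * Real.exp (-(κ * torusTreeLen Y.1)) := hbd z (hbox hz)
  rw [hrep ⟨j, Y⟩ z]
  exact hbd'

/-- **E1′ ON W1's CARRIERS OF RECORD WITH W2 := H-LAYER DATA** [bookkeeping] — `LeafIndex.ne5_of_leaves_fibre` BY NAME over `histCarriers (F.P K) M p`, its
W2 leaves manufactured from §1's envelope; every other leaf displayed; conclusion literally `T4OutputRate.NE5 EA EB W κ θ′ C₅` for ANY functionals `EA ∕ EB` on
W1's carriers (e.g. `W1.functionalOn S p embA` and `Re E_B(pair ·; b∷·; embB ·)` of the reading). [cite: Balaban1988RG2Cluster, Lemma 3 (2.38) p.20; Balaban1987RG1, Thm 1 p.259] -/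
theorem ne5_of_leaves_fibre_activities_histCarriers
    {act : (j : ℕ) → Op × Hist → TDom 4 (domCount (F.P K) M j) → ℂ} {W : Set (ℕ → ℝ)} {A Rd κ : ℝ}
    (hrep : ∀ (X : Node00.W1.Dom (F.P K) M) (z : Op × Hist),
      Mdl.Out X.1 z.1 z.2 X =
        locE (TTouch (d := 4) (N := domCount (F.P K) M X.1)) (fun Z : (tsys 4 (domCount (F.P K) M X.1)).Dom => Z.1) (act X.1 z) X.2.1)
    (hA : 0 ≤ A) (hκ : 0 ≤ κ) (hrate : κ + 2 * (64 * Real.log 162) + 2 ≤ Rd)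
    (hsmall : A * Real.exp (5 * κ + 1) * K₀ 64 8 * 9 * 64 ≤ 1)
    (hH : ∀ j, ∀ g ∈ W, ∀ (U : p.BgB) (q : Op × Hist), q ∈ Mdl.Base j g U →
      ∃ V : Set (Op × Hist), IsOpen V ∧ Mdl.box j q ⊆ V ∧
        (∀ Z : TDom 4 (domCount (F.P K) M j), DifferentiableOn ℂ (fun z : Op × Hist => act j z Z) V) ∧
        (∀ z ∈ V, ∀ Z : TDom 4 (domCount (F.P K) M j), ‖act j z Z‖ ≤ A * Real.exp (-(Rd * torusTreeLen Z.1))))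
    {EA : Functional (Node00.W1.histCarriers (F.P K) M p) p.BgA} {EB : Functional (Node00.W1.histCarriers (F.P K) M p) p.BgB}
    {EA₀ E₀ E₁ δ δ' θ θ' cH ω ρ₀ B : ℝ} {k₀ : ℕ}
    (l01 : L01 Mdl EA W) (l02 : L02 Mdl EB W) (l03 : L03 Mdl EB W) (l05 : L05 EA W EA₀ κ) (l06 : L06 EB W E₀ κ)
    (l07 : L07 Mdl W δ θ) (l08 : L08 Mdl W κ E₀ δ' θ) (l09aff : L09aff Mdl W) (l09blind : L09blind Mdl W) (l09hom : L09hom Mdl W)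
    (l09unit : L09unit Mdl W κ E₁ cH ω) (hE₁ : 0 < E₁) (hδ : 0 ≤ δ + δ') (hθ : 0 ≤ θ) (hθθ' : θ ≤ θ') (hθ'1 : θ' ≤ 1)
    (hcH : 0 ≤ cH) (hω : 0 < ω) (hρ₀ : ρ₀ < 1) (l10near : (δ + δ') * θ ^ k₀ + cH * (EA₀ + E₀) / (1 - ω) ≤ ρ₀) (hB : 0 ≤ B)
    (l10first : ∀ k < k₀, EA₀ + E₀ ≤ B * θ ^ k)
    (l11 : ω + Real.exp 1 * 9 * 64 * K₀ 64 8 ^ 2 * A / (1 - ρ₀) * cH < θ') :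
    NE5 EA EB W κ θ'
      ((Real.exp 1 * 9 * 64 * K₀ 64 8 ^ 2 * A / (1 - ρ₀) * (δ + δ') + B) * (θ' - ω) /
        (θ' - (ω + Real.exp 1 * 9 * 64 * K₀ 64 8 ^ 2 * A / (1 - ρ₀) * cH))) :=
  have henv := outputEnvelope_of_activities_histCarriers F K M p Mdl hrep hA hκ hrate hsmall hH
  ne5_of_leaves_fibre Mdl l01 l02 l03 (Mdl.opFibreEnvelope_of_outputEnvelope henv) (Mdl.histFibreEnvelope_of_outputEnvelope henv)
    l05 l06 l07 l08 l09aff l09blind l09hom l09unit hE₁ (by positivity) hδ hθ hθθ' hθ'1 hcH hω hρ₀ l10near hB l10first l11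

/-- **E1′ ON W1's CARRIERS OF RECORD AT MAJORANT CONSTANT `C₃·ε₁`, BOTH W2 CLAUSES AS ε₁-CONDITIONS** [bookkeeping] — §1 with `A := C₃·ε₁`: the [KP86]
clause supplied as `C₃ε₁·e^{5κ+1}·K₀(64,8)·576 ≤ 1`, L11 as the sharp clause `(e·576·K₀(64,8)²·C₃)·cH·ε₁ < (θ′−ω)(1−ρ₀)`
(`SmallnessPrintedKind.smallness_of_eps`). [cite: Balaban1988RG2Cluster, Lemma 3 (2.38)–(2.40) p.20; Balaban1987RG1, Thm 1 p.259] -/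
theorem ne5_of_leaves_fibre_activities_histCarriers_eps
    {act : (j : ℕ) → Op × Hist → TDom 4 (domCount (F.P K) M j) → ℂ} {W : Set (ℕ → ℝ)} {C3 ε₁ Rd κ : ℝ}
    (hrep : ∀ (X : Node00.W1.Dom (F.P K) M) (z : Op × Hist),
      Mdl.Out X.1 z.1 z.2 X =
        locE (TTouch (d := 4) (N := domCount (F.P K) M X.1)) (fun Z : (tsys 4 (domCount (F.P K) M X.1)).Dom => Z.1) (act X.1 z) X.2.1)
    (hC3 : 0 ≤ C3) (hε₁ : 0 ≤ ε₁) (hκ : 0 ≤ κ) (hrate : κ + 2 * (64 * Real.log 162) + 2 ≤ Rd)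
    (hKP : C3 * ε₁ * Real.exp (5 * κ + 1) * K₀ 64 8 * 9 * 64 ≤ 1)
    (hH : ∀ j, ∀ g ∈ W, ∀ (U : p.BgB) (q : Op × Hist), q ∈ Mdl.Base j g U →
      ∃ V : Set (Op × Hist), IsOpen V ∧ Mdl.box j q ⊆ V ∧
        (∀ Z : TDom 4 (domCount (F.P K) M j), DifferentiableOn ℂ (fun z : Op × Hist => act j z Z) V) ∧
        (∀ z ∈ V, ∀ Z : TDom 4 (domCount (F.P K) M j), ‖act j z Z‖ ≤ C3 * ε₁ * Real.exp (-(Rd * torusTreeLen Z.1))))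
    {EA : Functional (Node00.W1.histCarriers (F.P K) M p) p.BgA} {EB : Functional (Node00.W1.histCarriers (F.P K) M p) p.BgB}
    {EA₀ E₀ E₁ δ δ' θ θ' cH ω ρ₀ B : ℝ} {k₀ : ℕ}
    (l01 : L01 Mdl EA W) (l02 : L02 Mdl EB W) (l03 : L03 Mdl EB W) (l05 : L05 EA W EA₀ κ) (l06 : L06 EB W E₀ κ)
    (l07 : L07 Mdl W δ θ) (l08 : L08 Mdl W κ E₀ δ' θ) (l09aff : L09aff Mdl W) (l09blind : L09blind Mdl W) (l09hom : L09hom Mdl W)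
    (l09unit : L09unit Mdl W κ E₁ cH ω) (hE₁ : 0 < E₁) (hδ : 0 ≤ δ + δ') (hθ : 0 ≤ θ) (hθθ' : θ ≤ θ') (hθ'1 : θ' ≤ 1)
    (hcH : 0 ≤ cH) (hω : 0 < ω) (hρ₀ : ρ₀ < 1) (l10near : (δ + δ') * θ ^ k₀ + cH * (EA₀ + E₀) / (1 - ω) ≤ ρ₀) (hB : 0 ≤ B)
    (l10first : ∀ k < k₀, EA₀ + E₀ ≤ B * θ ^ k)
    (hS : Real.exp 1 * 9 * 64 * K₀ 64 8 ^ 2 * C3 * cH * ε₁ < (θ' - ω) * (1 - ρ₀)) :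
    NE5 EA EB W κ θ'
      ((Real.exp 1 * 9 * 64 * K₀ 64 8 ^ 2 * (C3 * ε₁) / (1 - ρ₀) * (δ + δ') + B) * (θ' - ω) /
        (θ' - (ω + Real.exp 1 * 9 * 64 * K₀ 64 8 ^ 2 * (C3 * ε₁) / (1 - ρ₀) * cH))) := by
  have l11 : ω + Real.exp 1 * 9 * 64 * K₀ 64 8 ^ 2 * (C3 * ε₁) / (1 - ρ₀) * cH < θ' := by
    have h := smallness_of_eps (G := Real.exp 1 * 9 * 64 * K₀ 64 8 ^ 2 * C3) (cI := cH) (ε₁ := ε₁) hρ₀ hS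
    have heq : Real.exp 1 * 9 * 64 * K₀ 64 8 ^ 2 * C3 / (1 - ρ₀) * (cH * ε₁) =
        Real.exp 1 * 9 * 64 * K₀ 64 8 ^ 2 * (C3 * ε₁) / (1 - ρ₀) * cH := by ring
    rwa [heq] at h
  exact ne5_of_leaves_fibre_activities_histCarriers F K M p Mdl hrep (mul_nonneg hC3 hε₁) hκ hrate hKP hH l01 l02 l03 l05 l06 l07
    l08 l09aff l09blind l09hom l09unit hE₁ hδ hθ hθθ' hθ'1 hcH hω hρ₀ l10near hB l10first l11

end HistCarriers

/-! ## §2 `N18At` at a W1 level pairing, member by member — module 1's `n18At_of_envelopeOnRecord` twin WITHOUT `TwoRuns` -/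

section Pairing

variable {F : T4Family} {𝔸 : Type*} {M k : ℕ} (R : Node00.W1.LevelPairing F 𝔸 M k)
variable {Op Hist : Type*} [NormedAddCommGroup Op] [NormedSpace ℂ Op] [NormedAddCommGroup Hist] [NormedSpace ℂ Hist]
variable [∀ j, DecidableEq (TDom 4 (domCount (F.P k) M j))] [∀ j, DecidableRel (TTouch (d := 4) (N := domCount (F.P k) M j))]

/-- **N18 AT THE H-LAYER BUNDLE ON A W1 LEVEL PAIRING's CARRIERS** [bookkeeping]: for the level-`k` pairing data `R` (run A on `F.P k`, run B on `F.P (k+1)`;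
carriers `R.carriers = histCarriers (F.P k) M R.toRunPairing`) and, for every member `b ∈ ]0, γ]` of run B's first-coupling family, a step model `Mb b` OVER
`R.carriers` whose output at `⟨j, X⟩` IS (2.13) of scale-`j` activities `act b j` on the `k`-th torus's catalogue (`hrep`) carrying THE NODE-A MAJORANT AS
HYPOTHESIS (`hH`), run A's functional `EA` and run B's family `EB b` (ANY functionals on `R.carriers`) with the leaves L01–L03 ∕ L05–L09unit, and ONCE the located
numerals, the [KP86] clause, the reach clause L10 and the sharp clause: §1 at each member gives `N18At ⟨R.carriers, W, γ, κ, EA, EB, θ′, C₅(C₃ε₁), …⟩` with ONE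
`θ′` and ONE `C₅` (any NE9 ∕ read-out letters). [cite: Balaban1988RG2Cluster, Lemma 3 (2.38) p.20 and (2.13) p.14; Balaban1987RG1, (0.24)–(0.25) p.257 and Thm 1 p.259] -/
theorem n18At_pairing_of_envelopeOnW1Carriers (Mb : ℝ → StepModel R.carriers Op Hist)
    {act : ℝ → (j : ℕ) → Op × Hist → TDom 4 (domCount (F.P k) M j) → ℂ} {W : Set (ℕ → ℝ)} {γ C3 ε₁ Rd κ : ℝ}
    {EA : Functional R.carriers R.BgA} {EB : ℝ → Functional R.carriers R.BgB} {EA₀ E₀ E₁ δ δ' θ θ' cH ω ρ₀ B : ℝ} {k₀ : ℕ}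
    (hrep : ∀ b : ℝ, 0 < b → b ≤ γ → ∀ (X : Node00.W1.Dom (F.P k) M) (z : Op × Hist),
      (Mb b).Out X.1 z.1 z.2 X =
        locE (TTouch (d := 4) (N := domCount (F.P k) M X.1)) (fun Z : (tsys 4 (domCount (F.P k) M X.1)).Dom => Z.1) (act b X.1 z) X.2.1)
    (hC3 : 0 ≤ C3) (hε₁ : 0 ≤ ε₁) (hκ : 0 ≤ κ) (hrate : κ + 2 * (64 * Real.log 162) + 2 ≤ Rd)
    (hKP : C3 * ε₁ * Real.exp (5 * κ + 1) * K₀ 64 8 * 9 * 64 ≤ 1)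
    (hH : ∀ b : ℝ, 0 < b → b ≤ γ → ∀ j, ∀ g ∈ W, ∀ (U : R.BgB) (q : Op × Hist), q ∈ (Mb b).Base j g U →
      ∃ V : Set (Op × Hist), IsOpen V ∧ (Mb b).box j q ⊆ V ∧
        (∀ Z : TDom 4 (domCount (F.P k) M j), DifferentiableOn ℂ (fun z : Op × Hist => act b j z Z) V) ∧
        (∀ z ∈ V, ∀ Z : TDom 4 (domCount (F.P k) M j), ‖act b j z Z‖ ≤ C3 * ε₁ * Real.exp (-(Rd * torusTreeLen Z.1))))
    (l01 : ∀ b : ℝ, 0 < b → b ≤ γ → L01 (Mb b) EA W) (l02 : ∀ b : ℝ, 0 < b → b ≤ γ → L02 (Mb b) (EB b) W)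
    (l03 : ∀ b : ℝ, 0 < b → b ≤ γ → L03 (Mb b) (EB b) W) (l05 : L05 EA W EA₀ κ)
    (l06 : ∀ b : ℝ, 0 < b → b ≤ γ → L06 (EB b) W E₀ κ) (l07 : ∀ b : ℝ, 0 < b → b ≤ γ → L07 (Mb b) W δ θ)
    (l08 : ∀ b : ℝ, 0 < b → b ≤ γ → L08 (Mb b) W κ E₀ δ' θ) (l09aff : ∀ b : ℝ, 0 < b → b ≤ γ → L09aff (Mb b) W)
    (l09blind : ∀ b : ℝ, 0 < b → b ≤ γ → L09blind (Mb b) W) (l09hom : ∀ b : ℝ, 0 < b → b ≤ γ → L09hom (Mb b) W)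
    (l09unit : ∀ b : ℝ, 0 < b → b ≤ γ → L09unit (Mb b) W κ E₁ cH ω)
    (hE₁ : 0 < E₁) (hδ : 0 ≤ δ + δ') (hθ : 0 ≤ θ) (hθθ' : θ ≤ θ') (hθ'1 : θ' ≤ 1) (hcH : 0 ≤ cH) (hω : 0 < ω) (hρ₀ : ρ₀ < 1)
    (l10near : (δ + δ') * θ ^ k₀ + cH * (EA₀ + E₀) / (1 - ω) ≤ ρ₀) (hB : 0 ≤ B) (l10first : ∀ k < k₀, EA₀ + E₀ ≤ B * θ ^ k)
    (hS : Real.exp 1 * 9 * 64 * K₀ 64 8 ^ 2 * C3 * cH * ε₁ < (θ' - ω) * (1 - ρ₀))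
    (Λ : ℕ → ℕ → ℝ) (C₉ ωm cr ρ : ℝ) :
    N18At ⟨R.carriers, W, γ, κ, EA, EB, θ',
      (Real.exp 1 * 9 * 64 * K₀ 64 8 ^ 2 * (C3 * ε₁) / (1 - ρ₀) * (δ + δ') + B) * (θ' - ω) /
        (θ' - (ω + Real.exp 1 * 9 * 64 * K₀ 64 8 ^ 2 * (C3 * ε₁) / (1 - ρ₀) * cH)), Λ, C₉, ωm, cr, ρ⟩ :=
  fun b hb hbγ =>
    ne5_of_leaves_fibre_activities_histCarriers_eps F k M R.toRunPairing (Mb b) (hrep b hb hbγ) hC3 hε₁ hκ hrate hKP (hH b hb hbγ)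
      (l01 b hb hbγ) (l02 b hb hbγ) (l03 b hb hbγ) l05 (l06 b hb hbγ) (l07 b hb hbγ) (l08 b hb hbγ) (l09aff b hb hbγ) (l09blind b hb hbγ)
      (l09hom b hb hbγ) (l09unit b hb hbγ) hE₁ hδ hθ hθθ' hθ'1 hcH hω hρ₀ l10near hB l10first hS

/-- **BOTH W2 CLAUSES AS ONE ε₁-THRESHOLD, AT A W1 LEVEL PAIRING** [bookkeeping; module 1's `n18At_of_envelopeOnRecord_eps` twin]: for letters `0 ≤ C₃`,
`0 ≤ c_H`, `0 < ω < θ′`, `ρ₀ < 1` (and the signs ∕ reach clause of the END) there is `ε⋆ > 0` — `EnvelopeOnRecord.eps_threshold_record`'s explicit minimum in the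
located numerals — such that for EVERY `ε₁ ∈ [0, ε⋆[` and EVERY member data over `R.carriers` (step models, activities on the `k`-th torus's catalogue,
functionals) obeying (2.13), the H-layer datum AT MAJORANT `C₃ε₁` and the leaves, `N18At` holds with `C₅(ε₁)`: the [KP86] clause and the sharp clause are
DISCHARGED by the smallness of `ε₁`. [cite: Balaban1988RG2Cluster, Lemma 3 (2.38)–(2.40) p.20; Balaban1987RG1, Thm 1 p.259] -/
theorem n18At_pairing_of_envelopeOnW1Carriers_eps {W : Set (ℕ → ℝ)} {γ C3 Rd κ EA₀ E₀ E₁ δ δ' θ θ' cH ω ρ₀ B : ℝ} {k₀ : ℕ}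
    (hC3 : 0 ≤ C3) (hκ : 0 ≤ κ) (hrate : κ + 2 * (64 * Real.log 162) + 2 ≤ Rd)
    (hE₁ : 0 < E₁) (hδ : 0 ≤ δ + δ') (hθ : 0 ≤ θ) (hθθ' : θ ≤ θ') (hθ'1 : θ' ≤ 1) (hcH : 0 ≤ cH) (hω : 0 < ω) (hωθ' : ω < θ')
    (hρ₀ : ρ₀ < 1) (l10near : (δ + δ') * θ ^ k₀ + cH * (EA₀ + E₀) / (1 - ω) ≤ ρ₀) (hB : 0 ≤ B)
    (l10first : ∀ k < k₀, EA₀ + E₀ ≤ B * θ ^ k) (Λ : ℕ → ℕ → ℝ) (C₉ ωm cr ρ : ℝ) :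
    ∃ εs : ℝ, 0 < εs ∧ ∀ ε₁ : ℝ, 0 ≤ ε₁ → ε₁ < εs →
      ∀ (Mb : ℝ → StepModel R.carriers Op Hist) (act : ℝ → (j : ℕ) → Op × Hist → TDom 4 (domCount (F.P k) M j) → ℂ)
        (EA : Functional R.carriers R.BgA) (EB : ℝ → Functional R.carriers R.BgB),
        (∀ b : ℝ, 0 < b → b ≤ γ → ∀ (X : Node00.W1.Dom (F.P k) M) (z : Op × Hist),
          (Mb b).Out X.1 z.1 z.2 X =
            locE (TTouch (d := 4) (N := domCount (F.P k) M X.1)) (fun Z : (tsys 4 (domCount (F.P k) M X.1)).Dom => Z.1) (act b X.1 z)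
              X.2.1) →
        (∀ b : ℝ, 0 < b → b ≤ γ → ∀ j, ∀ g ∈ W, ∀ (U : R.BgB) (q : Op × Hist), q ∈ (Mb b).Base j g U →
          ∃ V : Set (Op × Hist), IsOpen V ∧ (Mb b).box j q ⊆ V ∧
            (∀ Z : TDom 4 (domCount (F.P k) M j), DifferentiableOn ℂ (fun z : Op × Hist => act b j z Z) V) ∧
            (∀ z ∈ V, ∀ Z : TDom 4 (domCount (F.P k) M j), ‖act b j z Z‖ ≤ C3 * ε₁ * Real.exp (-(Rd * torusTreeLen Z.1)))) →
        (∀ b : ℝ, 0 < b → b ≤ γ → L01 (Mb b) EA W) → (∀ b : ℝ, 0 < b → b ≤ γ → L02 (Mb b) (EB b) W) →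
        (∀ b : ℝ, 0 < b → b ≤ γ → L03 (Mb b) (EB b) W) → L05 EA W EA₀ κ → (∀ b : ℝ, 0 < b → b ≤ γ → L06 (EB b) W E₀ κ) →
        (∀ b : ℝ, 0 < b → b ≤ γ → L07 (Mb b) W δ θ) → (∀ b : ℝ, 0 < b → b ≤ γ → L08 (Mb b) W κ E₀ δ' θ) →
        (∀ b : ℝ, 0 < b → b ≤ γ → L09aff (Mb b) W) → (∀ b : ℝ, 0 < b → b ≤ γ → L09blind (Mb b) W) →
        (∀ b : ℝ, 0 < b → b ≤ γ → L09hom (Mb b) W) → (∀ b : ℝ, 0 < b → b ≤ γ → L09unit (Mb b) W κ E₁ cH ω) →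
        N18At ⟨R.carriers, W, γ, κ, EA, EB, θ',
          (Real.exp 1 * 9 * 64 * K₀ 64 8 ^ 2 * (C3 * ε₁) / (1 - ρ₀) * (δ + δ') + B) * (θ' - ω) /
            (θ' - (ω + Real.exp 1 * 9 * 64 * K₀ 64 8 ^ 2 * (C3 * ε₁) / (1 - ρ₀) * cH)), Λ, C₉, ωm, cr, ρ⟩ := by
  obtain ⟨εs, hεs, hthr⟩ := eps_threshold_record (κ := κ) hC3 hcH hωθ' hρ₀
  refine ⟨εs, hεs, fun ε₁ hε₁ hε₁s Mb act EA EB hrep hH l01 l02 l03 l05 l06 l07 l08 l09aff l09blind l09hom l09unit => ?_⟩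
  obtain ⟨hKP, hS⟩ := hthr ε₁ hε₁s
  exact n18At_pairing_of_envelopeOnW1Carriers R Mb hrep hC3 hε₁ hκ hrate hKP hH l01 l02 l03 l05 l06 l07 l08 l09aff l09blind l09hom
    l09unit hE₁ hδ hθ hθθ' hθ'1 hcH hω hρ₀ l10near hB l10first hS Λ C₉ ωm cr ρ

/-- **THE END's CONSTANT IS NONNEGATIVE, FROM THE LETTERS ALONE** [bookkeeping; module 4's in-proof computation as a lemma]: under the END's sign clauses
(`0 ≤ C₃`, `0 ≤ ε₁`, `0 ≤ δ + δ′`, `0 ≤ c_H`, `ρ₀ < 1`, `0 ≤ B`) and the sharp clause, `0 ≤ C₅(C₃ε₁)` — what letter domination by `N18AtByName.n18At_mono`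
needs. [folklore] -/
theorem endConstant_nonneg {C3 ε₁ δ δ' θ' cH ω ρ₀ B : ℝ} (hC3 : 0 ≤ C3) (hε₁ : 0 ≤ ε₁) (hδ : 0 ≤ δ + δ') (hcH : 0 ≤ cH) (hρ₀ : ρ₀ < 1)
    (hB : 0 ≤ B) (hS : Real.exp 1 * 9 * 64 * K₀ 64 8 ^ 2 * C3 * cH * ε₁ < (θ' - ω) * (1 - ρ₀)) :
    0 ≤ (Real.exp 1 * 9 * 64 * K₀ 64 8 ^ 2 * (C3 * ε₁) / (1 - ρ₀) * (δ + δ') + B) * (θ' - ω) /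
      (θ' - (ω + Real.exp 1 * 9 * 64 * K₀ 64 8 ^ 2 * (C3 * ε₁) / (1 - ρ₀) * cH)) := by
  have hK : 0 ≤ K₀ 64 8 := (B12TreeDecay.K₀_pos 64 8).le
  have hG : 0 ≤ Real.exp 1 * 9 * 64 * K₀ 64 8 ^ 2 * (C3 * ε₁) / (1 - ρ₀) := by
    have : 0 < 1 - ρ₀ := sub_pos.2 hρ₀
    positivity
  have hl11 : ω + Real.exp 1 * 9 * 64 * K₀ 64 8 ^ 2 * (C3 * ε₁) / (1 - ρ₀) * cH < θ' := by
    have h1 := smallness_of_eps (G := Real.exp 1 * 9 * 64 * K₀ 64 8 ^ 2 * C3) (cI := cH) (ε₁ := ε₁) hρ₀ hS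
    have heq : Real.exp 1 * 9 * 64 * K₀ 64 8 ^ 2 * C3 / (1 - ρ₀) * (cH * ε₁) =
        Real.exp 1 * 9 * 64 * K₀ 64 8 ^ 2 * (C3 * ε₁) / (1 - ρ₀) * cH := by ring
    rwa [heq] at h1
  refine div_nonneg (mul_nonneg (by positivity) (sub_nonneg.2 ?_)) (sub_nonneg.2 hl11.le)
  have : 0 ≤ Real.exp 1 * 9 * 64 * K₀ 64 8 ^ 2 * (C3 * ε₁) / (1 - ρ₀) * cH := mul_nonneg hG hcH
  linarith

end Pairing

/-! ## §3 At the named reading, per run length, NO maps of carriers -/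

open Classical in
/-- **N18 AT THE W1 READING's LEVEL-`k` BUNDLE OF RECORD FROM THE H-LAYER END ON THE READING's OWN CARRIERS** [bookkeeping] — NO map, NO identification
clause: for `𝔯_W1`'s input datum `𝔇`, a Stage-12 tuple `θ` and a run length `k`, per-member step models `Mb b` (`b ∈ ]0, γ′]`, `γ′ ≥ θ.γ`) OVER
`((𝔇.w1 F θ).pairing k).carriers` whose outputs ARE (2.13) of activities on the `k`-th torus's catalogue `tsys 4 (domCount (F.P k) θ.τ9.M j)` (`hrep`) with THE
NODE-A MAJORANT AS HYPOTHESIS (`hH`, [II] Lemma 3 (2.38), instanced by nobody), the leaves ON W1's OWN FUNCTIONALS — run A's `(pairing k).EA (S k)`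
(`(g, U, ⟨j, X⟩) ↦ Re E^{(j)}(X; g; embA U)`, the (2.13) terms of `S k`) and run B's `(pairing k).EB (S (k+1)) b` — on a window `W ⊇ ]0, θ.γ]^ℕ`, the located numerals,
the [KP86] clause, L10 and the sharp clause, and the reading's letters dominating (`κ_ℓ ≤ κ`, `θ′ ≤ θ₅`, `C₅(C₃ε₁) ≤ C₅`) ⇒ `N18At (u3OfRecord₁₂ θ (W1.assignment₁₂ 𝔇 F θ
g₀ os).u3 k)` — §2 ∘ `N18AtByName.n18At_mono` ∘ module 8's bundle equation.  The decidability instances of `locE` are the classical ones here.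
[cite: Balaban1988RG2Cluster, Lemma 3 (2.38) p.20 and (2.13) p.14; Balaban1987RG1, (0.24)–(0.25) p.257, (1.18) p.263 and Thm 1 p.259] -/
theorem n18At_u3OfRecord₁₂_w1_of_envelopeOnW1Carriers (𝔇 : Node00.W1.AssignmentInputs₁₂ N) (F : T4Family) (θ : Stage12Params F N) (g₀ : ℕ → ℝ)
    (os : List (ULoop F)) (k : ℕ) {Op Hist : Type*} [NormedAddCommGroup Op] [NormedSpace ℂ Op] [NormedAddCommGroup Hist] [NormedSpace ℂ Hist]
    (Mb : ℝ → StepModel ((𝔇.w1 F θ).pairing k).carriers Op Hist)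
    {act : ℝ → (j : ℕ) → Op × Hist → TDom 4 (domCount (F.P k) θ.τ9.M j) → ℂ} {W : Set (ℕ → ℝ)} {γ' C3 ε₁ Rd κ : ℝ}
    {EA₀ E₀ E₁ δ δ' θr θ' cH ω ρ₀ B : ℝ} {k₀ : ℕ}
    (hrep : ∀ b : ℝ, 0 < b → b ≤ γ' → ∀ (X : Node00.W1.Dom (F.P k) θ.τ9.M) (z : Op × Hist),
      (Mb b).Out X.1 z.1 z.2 X =
        locE (TTouch (d := 4) (N := domCount (F.P k) θ.τ9.M X.1)) (fun Z : (tsys 4 (domCount (F.P k) θ.τ9.M X.1)).Dom => Z.1) (act b X.1 z) X.2.1)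
    (hC3 : 0 ≤ C3) (hε₁ : 0 ≤ ε₁) (hκ : 0 ≤ κ) (hrate : κ + 2 * (64 * Real.log 162) + 2 ≤ Rd)
    (hKP : C3 * ε₁ * Real.exp (5 * κ + 1) * K₀ 64 8 * 9 * 64 ≤ 1)
    (hH : ∀ b : ℝ, 0 < b → b ≤ γ' → ∀ j, ∀ g ∈ W, ∀ (U : ((𝔇.w1 F θ).pairing k).BgB) (q : Op × Hist), q ∈ (Mb b).Base j g U →
      ∃ V : Set (Op × Hist), IsOpen V ∧ (Mb b).box j q ⊆ V ∧
        (∀ Z : TDom 4 (domCount (F.P k) θ.τ9.M j), DifferentiableOn ℂ (fun z : Op × Hist => act b j z Z) V) ∧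
        (∀ z ∈ V, ∀ Z : TDom 4 (domCount (F.P k) θ.τ9.M j), ‖act b j z Z‖ ≤ C3 * ε₁ * Real.exp (-(Rd * torusTreeLen Z.1))))
    (l01 : ∀ b : ℝ, 0 < b → b ≤ γ' → L01 (Mb b) (((𝔇.w1 F θ).pairing k).EA ((𝔇.w1 F θ).S k)) W)
    (l02 : ∀ b : ℝ, 0 < b → b ≤ γ' → L02 (Mb b) (((𝔇.w1 F θ).pairing k).EB ((𝔇.w1 F θ).S (k + 1)) b) W)
    (l03 : ∀ b : ℝ, 0 < b → b ≤ γ' → L03 (Mb b) (((𝔇.w1 F θ).pairing k).EB ((𝔇.w1 F θ).S (k + 1)) b) W)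
    (l05 : L05 (((𝔇.w1 F θ).pairing k).EA ((𝔇.w1 F θ).S k)) W EA₀ κ)
    (l06 : ∀ b : ℝ, 0 < b → b ≤ γ' → L06 (((𝔇.w1 F θ).pairing k).EB ((𝔇.w1 F θ).S (k + 1)) b) W E₀ κ)
    (l07 : ∀ b : ℝ, 0 < b → b ≤ γ' → L07 (Mb b) W δ θr) (l08 : ∀ b : ℝ, 0 < b → b ≤ γ' → L08 (Mb b) W κ E₀ δ' θr)
    (l09aff : ∀ b : ℝ, 0 < b → b ≤ γ' → L09aff (Mb b) W) (l09blind : ∀ b : ℝ, 0 < b → b ≤ γ' → L09blind (Mb b) W)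
    (l09hom : ∀ b : ℝ, 0 < b → b ≤ γ' → L09hom (Mb b) W) (l09unit : ∀ b : ℝ, 0 < b → b ≤ γ' → L09unit (Mb b) W κ E₁ cH ω)
    (hE₁ : 0 < E₁) (hδ : 0 ≤ δ + δ') (hθ : 0 ≤ θr) (hθθ' : θr ≤ θ') (hθ'1 : θ' ≤ 1) (hcH : 0 ≤ cH) (hω : 0 < ω) (hρ₀ : ρ₀ < 1)
    (l10near : (δ + δ') * θr ^ k₀ + cH * (EA₀ + E₀) / (1 - ω) ≤ ρ₀) (hB : 0 ≤ B) (l10first : ∀ k < k₀, EA₀ + E₀ ≤ B * θr ^ k)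
    (hS : Real.exp 1 * 9 * 64 * K₀ 64 8 ^ 2 * C3 * cH * ε₁ < (θ' - ω) * (1 - ρ₀))
    (hW : Window θ.γ ⊆ W) (hγ : θ.γ ≤ γ') (hℓκ : (𝔇.w1 F θ).li.κ ≤ κ) (hℓθ : θ' ≤ (𝔇.w1 F θ).li.θ₅)
    (hℓC : (Real.exp 1 * 9 * 64 * K₀ 64 8 ^ 2 * (C3 * ε₁) / (1 - ρ₀) * (δ + δ') + B) * (θ' - ω) /
        (θ' - (ω + Real.exp 1 * 9 * 64 * K₀ 64 8 ^ 2 * (C3 * ε₁) / (1 - ρ₀) * cH)) ≤ (𝔇.w1 F θ).li.C₅) :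
    N18At (u3OfRecord₁₂ θ (Node00.W1.assignment₁₂ 𝔇 F θ g₀ os).u3 k) := by
  have h := n18At_pairing_of_envelopeOnW1Carriers ((𝔇.w1 F θ).pairing k) Mb hrep hC3 hε₁ hκ hrate hKP hH l01 l02 l03 l05 l06 l07 l08
    l09aff l09blind l09hom l09unit hE₁ hδ hθ hθθ' hθ'1 hcH hω hρ₀ l10near hB l10first hS ((𝔇.w1 F θ).li.analytic θ.γ).moduli
    ((𝔇.w1 F θ).li.analytic θ.γ).C₉ ((𝔇.w1 F θ).li.analytic θ.γ).ω (𝔇.w1 F θ).li.cr (𝔇.w1 F θ).li.ρ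
  exact (n18At_u3OfRecord₁₂_w1_iff_pairing 𝔇 F θ g₀ os k).2
    (n18At_mono h hW hγ hℓκ (hθ.trans hθθ') hℓθ (endConstant_nonneg hC3 hε₁ hδ hcH hρ₀ hB hS) hℓC)

/-! ## §4 The row at the named reading on W1's own carriers -/

open Classical in
/-- **THE ROW AT THE NAMED READING, ON THE READING's OWN CARRIERS** [bookkeeping] — «knit `T4OutputRate.NE5` from `EnvelopeOnRecord*` faces with the NODE-A
majorant as hypothesis at `RRec`», Stage 12, at `𝔯_W1 := RateReading₁₂.ofAssignment (W1.assignment₁₂ 𝔇) ne1`, with NO map of carriers and NO identification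
clause: if at EVERY admissible Stage-12 tuple `θ` with provisos and every run length `k` there are data spaces, per-member step models OVER THE READING's level-`k`
carriers representing (2.13) of activities on the `k`-th torus's catalogue with THE NODE-A MAJORANT AS HYPOTHESIS, the leaves L01–L03 ∕ L05–L09unit ON THE
READING's OWN FUNCTIONALS, the located numerals, the [KP86] clause, L10, the sharp clause, and the reading's letters dominating the END's, then
`S_N18 (RRec₁₂ 𝔯_W1)` — §3 once per key and level.  What the hypothesis asks for is exactly the H-layer ACTIVITY DATUM on the record's torus catalogue
(dag-n18-c's row s1) + rows NE2 ∕ NE3's rates; nothing of it is supplied here. [cite: Balaban1988RG2Cluster, Lemma 3 (2.38) p.20 and (2.13) p.14; Balaban1987RG1, Thm 1 p.259] -/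
theorem s_N18_rRec₁₂_w1_of_envelopeOnW1Carriers (𝔇 : Node00.W1.AssignmentInputs₁₂ N)
    (ne1 : (F : T4Family) → Stage12Params F N → (ℕ → ℝ) → List (ULoop F) → NE1pCarriers)
    (h : ∀ (F : T4Family) (θ : Stage12Params F N), θ.Provisos₁₂ F N → θ.Admissible F N → ∀ k : ℕ,
      ∃ (Op : Type) (_ : NormedAddCommGroup Op) (_ : NormedSpace ℂ Op) (Hist : Type) (_ : NormedAddCommGroup Hist) (_ : NormedSpace ℂ Hist)
        (Mb : ℝ → StepModel ((𝔇.w1 F θ).pairing k).carriers Op Hist)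
        (act : ℝ → (j : ℕ) → Op × Hist → TDom 4 (domCount (F.P k) θ.τ9.M j) → ℂ) (W : Set (ℕ → ℝ)) (γ' C3 ε₁ Rd κ : ℝ)
        (EA₀ E₀ E₁ δ δ' θr θ' cH ω ρ₀ B : ℝ) (k₀ : ℕ),
        (∀ b : ℝ, 0 < b → b ≤ γ' → ∀ (X : Node00.W1.Dom (F.P k) θ.τ9.M) (z : Op × Hist),
          (Mb b).Out X.1 z.1 z.2 X =
            locE (TTouch (d := 4) (N := domCount (F.P k) θ.τ9.M X.1)) (fun Z : (tsys 4 (domCount (F.P k) θ.τ9.M X.1)).Dom => Z.1)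
              (act b X.1 z) X.2.1) ∧
        0 ≤ C3 ∧ 0 ≤ ε₁ ∧ 0 ≤ κ ∧ κ + 2 * (64 * Real.log 162) + 2 ≤ Rd ∧
        C3 * ε₁ * Real.exp (5 * κ + 1) * K₀ 64 8 * 9 * 64 ≤ 1 ∧
        (∀ b : ℝ, 0 < b → b ≤ γ' → ∀ j, ∀ g ∈ W, ∀ (U : ((𝔇.w1 F θ).pairing k).BgB) (q : Op × Hist), q ∈ (Mb b).Base j g U →
          ∃ V : Set (Op × Hist), IsOpen V ∧ (Mb b).box j q ⊆ V ∧
            (∀ Z : TDom 4 (domCount (F.P k) θ.τ9.M j), DifferentiableOn ℂ (fun z : Op × Hist => act b j z Z) V) ∧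
            (∀ z ∈ V, ∀ Z : TDom 4 (domCount (F.P k) θ.τ9.M j), ‖act b j z Z‖ ≤ C3 * ε₁ * Real.exp (-(Rd * torusTreeLen Z.1)))) ∧
        (∀ b : ℝ, 0 < b → b ≤ γ' → L01 (Mb b) (((𝔇.w1 F θ).pairing k).EA ((𝔇.w1 F θ).S k)) W) ∧
        (∀ b : ℝ, 0 < b → b ≤ γ' → L02 (Mb b) (((𝔇.w1 F θ).pairing k).EB ((𝔇.w1 F θ).S (k + 1)) b) W) ∧
        (∀ b : ℝ, 0 < b → b ≤ γ' → L03 (Mb b) (((𝔇.w1 F θ).pairing k).EB ((𝔇.w1 F θ).S (k + 1)) b) W) ∧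
        L05 (((𝔇.w1 F θ).pairing k).EA ((𝔇.w1 F θ).S k)) W EA₀ κ ∧
        (∀ b : ℝ, 0 < b → b ≤ γ' → L06 (((𝔇.w1 F θ).pairing k).EB ((𝔇.w1 F θ).S (k + 1)) b) W E₀ κ) ∧
        (∀ b : ℝ, 0 < b → b ≤ γ' → L07 (Mb b) W δ θr) ∧ (∀ b : ℝ, 0 < b → b ≤ γ' → L08 (Mb b) W κ E₀ δ' θr) ∧
        (∀ b : ℝ, 0 < b → b ≤ γ' → L09aff (Mb b) W) ∧ (∀ b : ℝ, 0 < b → b ≤ γ' → L09blind (Mb b) W) ∧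
        (∀ b : ℝ, 0 < b → b ≤ γ' → L09hom (Mb b) W) ∧ (∀ b : ℝ, 0 < b → b ≤ γ' → L09unit (Mb b) W κ E₁ cH ω) ∧
        0 < E₁ ∧ 0 ≤ δ + δ' ∧ 0 ≤ θr ∧ θr ≤ θ' ∧ θ' ≤ 1 ∧ 0 ≤ cH ∧ 0 < ω ∧ ρ₀ < 1 ∧
        (δ + δ') * θr ^ k₀ + cH * (EA₀ + E₀) / (1 - ω) ≤ ρ₀ ∧ 0 ≤ B ∧ (∀ k < k₀, EA₀ + E₀ ≤ B * θr ^ k) ∧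
        Real.exp 1 * 9 * 64 * K₀ 64 8 ^ 2 * C3 * cH * ε₁ < (θ' - ω) * (1 - ρ₀) ∧
        Window θ.γ ⊆ W ∧ θ.γ ≤ γ' ∧ (𝔇.w1 F θ).li.κ ≤ κ ∧ θ' ≤ (𝔇.w1 F θ).li.θ₅ ∧
        (Real.exp 1 * 9 * 64 * K₀ 64 8 ^ 2 * (C3 * ε₁) / (1 - ρ₀) * (δ + δ') + B) * (θ' - ω) /
            (θ' - (ω + Real.exp 1 * 9 * 64 * K₀ 64 8 ^ 2 * (C3 * ε₁) / (1 - ρ₀) * cH)) ≤ (𝔇.w1 F θ).li.C₅) :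
    S_N18 (RRec₁₂ (RateReading₁₂.ofAssignment (Node00.W1.assignment₁₂ 𝔇) ne1)) := by
  refine s_N18_rRec₁₂_of_forall_admissible _ fun F θ hP hA g₀ os k => ?_
  obtain ⟨Op, _, _, Hist, _, _, Mb, act, W, γ', C3, ε₁, Rd, κ, EA₀, E₀, E₁, δ, δ', θr, θ', cH, ω, ρ₀, B, k₀, hrep, hC3, hε₁, hκ, hrate, hKP,
    hH, l01, l02, l03, l05, l06, l07, l08, l09aff, l09blind, l09hom, l09unit, hE₁, hδ, hθ, hθθ', hθ'1, hcH, hω, hρ₀, l10near, hB, l10first, hS,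
    hW, hγ, hℓκ, hℓθ, hℓC⟩ := h F θ hP hA k
  exact n18At_u3OfRecord₁₂_w1_of_envelopeOnW1Carriers 𝔇 F θ g₀ os k Mb hrep hC3 hε₁ hκ hrate hKP hH l01 l02 l03 l05 l06 l07 l08 l09aff
    l09blind l09hom l09unit hE₁ hδ hθ hθθ' hθ'1 hcH hω hρ₀ l10near hB l10first hS hW hγ hℓκ hℓθ hℓC

end YMDAG.N18.W1Reading

end
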